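import Summits.CriticalPhenomena.PercolationContinuityZ3.Theorems.PercNearOneGluingNoHeavyLowerTailAntitheticFrozenPieces
import HarnessLib

/-!
# `NoHeavyLowerTail` (stmt-CriticalPhenomena-4575) — antithetic cluster pairs: MONOTONE CUBES and the SYMMETRIC-HARRIS-TREE leaf lemma
# (prim-hp-2 gen 52, MEMO-gen52 §2)

Support file (`--supports stmt-CriticalPhenomena-4575`, hull-port prover `prim-hp-2`, gen 52).  No definitions, no named facts, no sorries;
standard axioms.

A MONOTONE CUBE is a map `T ↦ (Wr T, Wb T)` from the Boolean lattice `Set ι` to pairs of vertex sets with `Wr` monotone and `Wb` antitone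
(think: red / blue vertex clusters of `s` along a family of colourings indexed by `T`), satisfying the ANTIPODAL DOMINATION condition
`Wb Tᶜ ⊆ Wr T` for all `T` (or the reverse inclusion for all `T`).  Then for increasing vertex functions `F, G`
`0 ≤ Σ_T (F(Wr T) − F(Wb T))·(G(Wr T) − G(Wb T))` (`Antithetic.monotone_cube_sum_nonneg`): Harris' inequality for the uniform measure on
`Set ι` (`Antithetic.harris_uniform_cov`) bounds the sum below by `(Σ_T a T)(Σ_T b T)/2^{|ι|}`, and pairing `T` with `Tᶜ` shows that both odd
means have the same sign.  This one lemma contains the abstract-cube certificate (`cube_sum_nonneg`, where domination holds with equality),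
the lobe-family theorem (`family_sum_nonneg`) and the frozen pieces.

**SUB-CUBE LEMMA** (`Antithetic.subcube_sum_nonneg`, MEMO-gen52 §2): for a monotone family of colourings `T ↦ ω T` of `E` (e.g. a leaf of a
decision tree: `ω T = π ∪ {e_i : i ∈ T}`, known red edges `π`, free edges `e_i`) whose clusters satisfy antipodal domination
`W'(ω Tᶜ) ⊆ W(ω T)` for all `T` (or the reverse), `0 ≤ Σ_T Δ_{F,G}(ω T)`.  A SYMMETRIC HARRIS TREE (MEMO-gen52 §2: a decision tree on edges
whose query rule is invariant under complementing the answers, every leaf either disjoint from `D(R)` or inside `D(R)` with antipodal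
domination against its mirror leaf) therefore certifies `Σ_{D(R)} Δ_{F,G} ≥ 0`, leaf pair by leaf pair; such trees exist for every
`(G,s,R)` with `|V| ≤ 5` (670/670 classes, 16 of them with glued blocks; MEMO-gen52 §3).
[cite: VandenbergHaggstromKahn2005, §1 p. 6 ("Harris' inequality")]
-/

noncomputable section

namespace Summit.CriticalPhenomena.PercolationContinuityZ3.Theorems

open Literature.Probability.Percolation
open scoped Classical symmDiff

namespace Antithetic

section MonotoneCube

variable {V : Type*} {ι : Type*} [Fintype ι]

/-- **Monotone-cube lemma** (MEMO-gen52 §2).  `Wr` monotone, `Wb` antitone on `Set ι`, antipodal domination `Wb Tᶜ ⊆ Wr T` for all `T` (or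
`Wr T ⊆ Wb Tᶜ` for all `T`); then `0 ≤ Σ_T (F(Wr T) − F(Wb T))(G(Wr T) − G(Wb T))` for monotone `F, G`. [this work] -/
theorem monotone_cube_sum_nonneg (Wr Wb : Set ι → Set V) (hWr : Monotone Wr) (hWb : Antitone Wb)
    (hdom : (∀ T, Wb Tᶜ ⊆ Wr T) ∨ (∀ T, Wr T ⊆ Wb Tᶜ))
    {F G : Set V → ℝ} (hF : Monotone F) (hG : Monotone G) :
    0 ≤ ∑ T : Set ι, (F (Wr T) - F (Wb T)) * (G (Wr T) - G (Wb T)) := by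
  let a : Set ι → ℝ := fun T => F (Wr T) - F (Wb T)
  let b : Set ι → ℝ := fun T => G (Wr T) - G (Wb T)
  show 0 ≤ ∑ T : Set ι, a T * b T
  have ha : Monotone a := fun T T' hTT' => sub_le_sub (hF (hWr hTT')) (hF (hWb hTT'))
  have hb : Monotone b := fun T T' hTT' => sub_le_sub (hG (hWr hTT')) (hG (hWb hTT'))
  have hsumc : ∀ (c : Set ι → ℝ), ∑ T : Set ι, c Tᶜ = ∑ T : Set ι, c T := fun c =>
    Fintype.sum_equiv (Equiv.mk compl compl compl_compl compl_compl) _ _ fun T => rfl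
  -- twice an odd mean is a sum of antipodal pairs
  have htwice : ∀ {H : Set V → ℝ}, 2 * ∑ T : Set ι, (H (Wr T) - H (Wb T)) =
      ∑ T : Set ι, ((H (Wr T) - H (Wb T)) + (H (Wr Tᶜ) - H (Wb Tᶜ))) := by
    intro H
    rw [Finset.sum_add_distrib, hsumc (fun T => H (Wr T) - H (Wb T))]; ring
  -- the product of the two odd means is nonnegative in either domination regime
  have hprod : 0 ≤ (∑ T, a T) * ∑ T, b T := by
    rcases hdom with hd | hd
    · have hmean : ∀ {H : Set V → ℝ}, Monotone H → 0 ≤ ∑ T : Set ι, (H (Wr T) - H (Wb T)) := by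
        intro H hH
        have h3 : 0 ≤ ∑ T : Set ι, ((H (Wr T) - H (Wb T)) + (H (Wr Tᶜ) - H (Wb Tᶜ))) :=
          Finset.sum_nonneg fun T _ => by
            have h1 : H (Wb Tᶜ) ≤ H (Wr T) := hH (hd T)
            have h2 : H (Wb T) ≤ H (Wr Tᶜ) := by
              have := hd Tᶜ; rw [compl_compl] at this; exact hH this
            linarith
        have := htwice (H := H)
        linarith
      exact mul_nonneg (hmean hF) (hmean hG)
    · have hmean : ∀ {H : Set V → ℝ}, Monotone H → ∑ T : Set ι, (H (Wr T) - H (Wb T)) ≤ 0 := by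
        intro H hH
        have h3 : ∑ T : Set ι, ((H (Wr T) - H (Wb T)) + (H (Wr Tᶜ) - H (Wb Tᶜ))) ≤ 0 :=
          Finset.sum_nonpos fun T _ => by
            have h1 : H (Wr T) ≤ H (Wb Tᶜ) := hH (hd T)
            have h2 : H (Wr Tᶜ) ≤ H (Wb T) := by
              have := hd Tᶜ; rw [compl_compl] at this; exact hH this
            linarith
        have := htwice (H := H)
        linarith
      exact mul_nonneg_of_nonpos_of_nonpos (hmean hF) (hmean hG)
  have hH := harris_uniform_cov ha hb
  have hN : (0 : ℝ) < (Fintype.card (Set ι) : ℝ) := by exact_mod_cast Fintype.card_pos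
  nlinarith

/-- **Sub-cube lemma / symmetric-Harris-tree leaf lemma** (MEMO-gen52 §2).  For a monotone family `T ↦ ω T` of colourings of `E` (e.g. the
completions `π ∪ {e_i : i ∈ T}` of a partial colouring) with antipodal domination of the clusters of `s` —
`W'(ω Tᶜ) ⊆ W(ω T)` for every `T`, or `W(ω T) ⊆ W'(ω Tᶜ)` for every `T` — the antithetic sum `Σ_T Δ_{F,G}(ω T)` is nonnegative. [this work] -/
theorem subcube_sum_nonneg (E : Set (Sym2 V)) (s : V) (ω : Set ι → Set (Sym2 V)) (hω : Monotone ω)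
    (hdom : (∀ T, openCluster ((ω Tᶜ)ᶜ ∩ E) s ⊆ openCluster (ω T ∩ E) s) ∨
      (∀ T, openCluster (ω T ∩ E) s ⊆ openCluster ((ω Tᶜ)ᶜ ∩ E) s))
    {F G : Set V → ℝ} (hF : Monotone F) (hG : Monotone G) :
    0 ≤ ∑ T : Set ι, (F (openCluster (ω T ∩ E) s) - F (openCluster ((ω T)ᶜ ∩ E) s)) *
      (G (openCluster (ω T ∩ E) s) - G (openCluster ((ω T)ᶜ ∩ E) s)) := by
  -- enlarging the open edge set enlarges the cluster
  have mono : ∀ {A B : Set (Sym2 V)}, A ⊆ B → openCluster A s ⊆ openCluster B s := by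
    intro A B h v hv
    refine hv.mono ?_
    intro a b hab
    rw [openGraph_adj] at hab ⊢
    exact ⟨h hab.1, hab.2⟩
  exact monotone_cube_sum_nonneg (fun T => openCluster (ω T ∩ E) s) (fun T => openCluster ((ω T)ᶜ ∩ E) s)
    (fun T T' hTT' => mono (Set.inter_subset_inter_left E (hω hTT')))
    (fun T T' hTT' => mono (Set.inter_subset_inter_left E (Set.compl_subset_compl.2 (hω hTT'))))
    hdom hF hG

end MonotoneCube

end Antithetic

end Summit.CriticalPhenomena.PercolationContinuityZ3.Theorems
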